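import Literature.NumberTheory.EllipticCurves.KubertTateFiveVeluIsogeny
import Literature.NumberTheory.EllipticCurves.ConstantKernelIsogenySelmerTrivial
import Literature.NumberTheory.GaloisRepresentations.HeckeCharacterProofs
import HarnessLib

/-!
# `Sel^φ(E_{m,n}/ℚ) = 0` for the Kubert–Tate `5`-torsion family in the tame régime (class-wide)

PROOF-ONLY file (theorems only), topic `NumberTheory/EllipticCurves`. For `m, n ∈ ℤ` with
`E_{m,n} = kubertTateFive m n = [n-m, -mn, -mn², 0, 0]` elliptic (`Δ = m⁵n⁵(m² - 11mn - n²) ≠ 0`)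
and Vélu's `5`-isogeny `φ = fiveIsogeny m n : E_{m,n} → E'_{m,n} = E_{m,n}/⟨(0,0)⟩` of
`KubertTateFiveVeluIsogeny` (kernel the constant group `ℤ/5` of integral points), Mazur's étale-kernel
descent (tree `ConstantKernelDescent.selmerGroup_eq_bot`: tame inertia kills an unramified-or-tame
`ℤ/n`-valued character at every place, then Minkowski) gives:

**Theorem** (`selmerGroup_fiveIsogeny_eq_bot`). *If `5 ∤ Δ(E_{m,n})` and no prime `p ≡ 1 (mod 5)`
divides `Δ(E_{m,n})`, then `Sel^φ(E_{m,n}/ℚ) = 0`; hence `E'_{m,n}(ℚ) = φ(E_{m,n}(ℚ))`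
(`exists_toGeomPoints_eq`) and `Ш(E_{m,n}/ℚ)[φ] = 0` (`ker_shaMap_fiveIsogeny_eq_bot`).*

T. Fisher (JEMS 3 (2001), §§1–2) computes `Sel^φ` and `Sel^{φ̂}` for this family in general by
class-field theory; the régime here is the one in which `Sel^φ` vanishes for the elementary reason
above. `selmerGroup_fiveIsogeny_eq_bot_13_14` is the instance `(m, n) = (13, 14)` (the rank-`2` curve
`[1, -182, -2548, 0, 0]`, `Δ = -2⁵·7⁵·13⁵·2029`), a second proof of
`KubertTate1314.selmerGroup_fiveIsogeny_eq_bot` as a specialisation of the family.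

## References

* [Mazur1977] B. Mazur, *Modular curves and the Eisenstein ideal*, Ch. III §3 Thm. (3.1), Ch. I §1(g).
* [Fisher2001FiveSevenDescent] T. Fisher, *Some examples of 5 and 7 descent for elliptic curves
  over ℚ*, JEMS 3 (2001) 169–201, §§1–2.
* [Kubert1976] D. S. Kubert, *Universal bounds on the torsion of elliptic curves*, Table 3.
* [SilvermanAEC2009] J. H. Silverman, *AEC*, 2nd ed., Thm. X.4.2.
-/

noncomputable section

open scoped Classical
open Polynomial WeierstrassCurve NumberField IsDedekindDomain Field
open Literature.NumberTheory.EllipticCurves Literature.NumberTheory.GaloisRepresentations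

namespace Literature.NumberTheory.EllipticCurves

namespace KubertTateVelu

/-! ### Over `ℚ` with integer parameters: the étale/tame régime -/

section Rat

/-- Two affine points with equal coordinates are equal (proof-irrelevant form). [folklore] -/
private theorem some_eq_some_of_eq {R : Type*} [CommRing R] {V : WeierstrassCurve R}
    {x y x' y' : R} (hx : x = x') (hy : y = y') (h : V.toAffine.Nonsingular x y)
    (h' : V.toAffine.Nonsingular x' y') : Affine.Point.some x y h = Affine.Point.some x' y' h' := by
  subst hx hy; rfl

variable (m n : ℤ) [hE : (kubertTateFive (m : ℚ) (n : ℚ)).IsElliptic]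

omit hE in
/-- The integer model. [cite: Kubert1976, Table 3 (N = 5)] -/
theorem eq_map_int : kubertTateFive (m : ℚ) (n : ℚ) = (kubertTateFive m n).map (Int.castRingHom ℚ) := by
  rw [map_kubertTateFive]; rfl

/-- **The kernel points are integral**: a non-zero `P ∈ ker φ` is `(a, b)` with
`(a, b) ∈ {(0,0), (0,mn²), (mn,m²n), (mn,0)} ⊂ ℤ²`. [cite: Velu1971, formulae] -/
theorem exists_int_of_mem_ker (P : geomPoints (kubertTateFive (m : ℚ) (n : ℚ)))
    (hP : P ∈ (fiveIsogeny (m : ℚ) (n : ℚ)).toAddMonoidHom.ker) (hP0 : P ≠ 0) :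
    ∃ (a b : ℤ) (h : ((kubertTateFive (m : ℚ) (n : ℚ)).baseChange (AlgebraicClosure ℚ)).toAffine.Nonsingular
      (a : AlgebraicClosure ℚ) (b : AlgebraicClosure ℚ)), P = Affine.Point.some _ _ h := by
  have hP' : fiveIsogeny (m : ℚ) (n : ℚ) P = 0 := hP
  have cast : ∀ z : ℤ, algebraMap ℚ (AlgebraicClosure ℚ) (z : ℚ) = ((z : ℤ) : AlgebraicClosure ℚ) :=
    fun z ↦ by rw [map_intCast]
  have c0 : ((0 : ℤ) : AlgebraicClosure ℚ) = 0 := Int.cast_zero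
  have c1 : (((m * n ^ 2 : ℤ)) : AlgebraicClosure ℚ) = algebraMap ℚ (AlgebraicClosure ℚ) ((m : ℚ) * (n : ℚ) ^ 2) := by
    rw [← cast]; push_cast; rfl
  have c2 : (((m * n : ℤ)) : AlgebraicClosure ℚ) = algebraMap ℚ (AlgebraicClosure ℚ) ((m : ℚ) * (n : ℚ)) := by
    rw [← cast]; push_cast; rfl
  have c3 : (((m ^ 2 * n : ℤ)) : AlgebraicClosure ℚ) = algebraMap ℚ (AlgebraicClosure ℚ) ((m : ℚ) ^ 2 * (n : ℚ)) := by
    rw [← cast]; push_cast; rfl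
  rcases mem_ker_fiveIsogeny_imp (m : ℚ) (n : ℚ) hP' with rfl | ⟨x, y, h, rfl, hxy⟩
  · exact absurd rfl hP0
  rcases hxy with ⟨hx, hy | hy⟩ | ⟨hx, hy | hy⟩ <;> subst hx <;> subst hy
  · exact ⟨0, 0, by rw [c0]; exact h, some_eq_some_of_eq c0.symm c0.symm _ _⟩
  · exact ⟨0, m * n ^ 2, by rw [c0, c1]; exact h, some_eq_some_of_eq c0.symm c1.symm _ _⟩
  · exact ⟨m * n, 0, by rw [c0, c2]; exact h, some_eq_some_of_eq c2.symm c0.symm _ _⟩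
  · exact ⟨m * n, m ^ 2 * n, by rw [c2, c3]; exact h, some_eq_some_of_eq c2.symm c3.symm _ _⟩

omit hE in
/-- **The étale/tame hypothesis place by place**, from `5 ∤ Δ` and "no bad prime is `≡ 1 (mod 5)`":
every finite place `v` of `ℚ` has `Δ(E_{m,n}) ∉ v`, or `5 ∉ v` and `gcd(5, N v - 1) = 1`.
[cite: Mazur1977, Ch. I §1(g)] -/
theorem etale_or_tame (h5 : ¬ (5 : ℤ) ∣ (kubertTateFive m n).Δ)
    (h1 : ∀ p : ℕ, p.Prime → (p : ℤ) ∣ (kubertTateFive m n).Δ → p % 5 ≠ 1)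
    (v : HeightOneSpectrum (𝓞 ℚ)) :
    (((kubertTateFive m n).Δ : ℤ) : 𝓞 ℚ) ∉ v.asIdeal ∨
      (((5 : ℕ) : 𝓞 ℚ) ∉ v.asIdeal ∧ Nat.Coprime 5 (v.residueCard - 1)) := by
  set p := Rat.HeightOneSpectrum.natGenerator v with hp
  have hpp : p.Prime := Rat.HeightOneSpectrum.prime_natGenerator v
  by_cases hdvd : (p : ℤ) ∣ (kubertTateFive m n).Δ
  · right
    have hres : v.residueCard = p := Rat.residueCard_eq_natGenerator v
    rw [Rat.natCast_mem_asIdeal_iff, hres, ← hp]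
    have hp5 : p ≠ 5 := by
      rintro h55; rw [h55] at hdvd; exact h5 (by exact_mod_cast hdvd)
    refine ⟨fun h ↦ hp5 ((Nat.prime_dvd_prime_iff_eq hpp Nat.prime_five).mp h), ?_⟩
    have hmod := h1 p hpp hdvd
    -- `gcd(5, p - 1) = 1` unless `5 ∣ p - 1`, i.e. `p ≡ 1 (mod 5)`
    rw [Nat.Prime.coprime_iff_not_dvd Nat.prime_five]
    intro h
    have := hpp.two_le
    omega
  · left
    rwa [Rat.intCast_mem_asIdeal_iff, ← hp]

/-! ### Conclusions (class-wide): `Sel^φ = 0`, `E'(ℚ) = φ(E(ℚ))`, `Ш[φ] = 0` -/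

/-- **`Sel^φ(E_{m,n}/ℚ) = 0` in the tame régime** (`m, n ∈ ℤ`, `E_{m,n}` elliptic,
`5 ∤ Δ = mn⁵(m² - 11mn - n²)⁵`-free form: `5 ∤ Δ(E_{m,n})`, and no prime `p ≡ 1 (mod 5)` divides
`Δ(E_{m,n})`): the `ℤ/5`-side of the `5`-descent via `φ : E_{m,n} → E_{m,n}/⟨(0,0)⟩` is empty, by
Mazur's étale-kernel descent (`ConstantKernelDescent.selmerGroup_eq_bot`: kernel constant and
integral, every place étale or tame, Minkowski).
[cite: Mazur1977, Ch. III §3 Thm. (3.1) with Ch. I §1(g); Fisher2001FiveSevenDescent, §§1–2] -/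
theorem selmerGroup_fiveIsogeny_eq_bot (h5 : ¬ (5 : ℤ) ∣ (kubertTateFive m n).Δ)
    (h1 : ∀ p : ℕ, p.Prime → (p : ℤ) ∣ (kubertTateFive m n).Δ → p % 5 ≠ 1) :
    (fiveIsogeny (m : ℚ) (n : ℚ)).selmerGroup = ⊥ :=
  ConstantKernelDescent.selmerGroup_eq_bot (fiveIsogeny (m : ℚ) (n : ℚ)) (kubertTateFive m n)
    (eq_map_int m n) (fun σ P hP ↦ smul_eq_of_mem_ker (m : ℚ) (n : ℚ) σ P hP)
    (exists_int_of_mem_ker m n) (n := 5) (by norm_num)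
    (fun P hP ↦ five_nsmul_eq_zero_of_mem_ker (m : ℚ) (n : ℚ) hP) (etale_or_tame m n h5 h1)

/-- **`E'_{m,n}(ℚ) = φ(E_{m,n}(ℚ))` in the tame régime**: every rational point of the isogenous
curve is the image of a rational point. [cite: SilvermanAEC2009, Thm. X.4.2(a)] -/
theorem exists_toGeomPoints_eq (h5 : ¬ (5 : ℤ) ∣ (kubertTateFive m n).Δ)
    (h1 : ∀ p : ℕ, p.Prime → (p : ℤ) ∣ (kubertTateFive m n).Δ → p % 5 ≠ 1)
    (P' : (kubertTateFive' (m : ℚ) (n : ℚ)).toAffine.Point) :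
    ∃ P : (kubertTateFive (m : ℚ) (n : ℚ)).toAffine.Point,
      (kubertTateFive' (m : ℚ) (n : ℚ)).toGeomPoints P' =
        fiveIsogeny (m : ℚ) (n : ℚ) ((kubertTateFive (m : ℚ) (n : ℚ)).toGeomPoints P) :=
  ConstantKernelDescent.exists_toGeomPoints_eq_of_selmerGroup_eq_bot (fiveIsogeny (m : ℚ) (n : ℚ))
    (selmerGroup_fiveIsogeny_eq_bot m n h5 h1) P'

/-- **`Ш(E_{m,n}/ℚ)[φ] = 0` in the tame régime**: the kernel of `Ш(φ) : Ш(E_{m,n}/ℚ) → Ш(E'_{m,n}/ℚ)`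
is trivial. [cite: SilvermanAEC2009, Thm. X.4.2(a)] -/
theorem ker_shaMap_fiveIsogeny_eq_bot (h5 : ¬ (5 : ℤ) ∣ (kubertTateFive m n).Δ)
    (h1 : ∀ p : ℕ, p.Prime → (p : ℤ) ∣ (kubertTateFive m n).Δ → p % 5 ≠ 1) :
    (shaMap (fiveIsogeny (m : ℚ) (n : ℚ)).toAddMonoidHom (fiveIsogeny (m : ℚ) (n : ℚ)).equivariant
      (fiveIsogeny (m : ℚ) (n : ℚ)).hasLocalPointsMaps_toAddMonoidHom).ker = ⊥ :=
  ConstantKernelDescent.ker_shaMap_eq_bot_of_selmerGroup_eq_bot (fiveIsogeny (m : ℚ) (n : ℚ))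
    (selmerGroup_fiveIsogeny_eq_bot m n h5 h1)

/-- Elementwise form: in the tame régime a class of `Ш(E_{m,n}/ℚ)` killed by `Ш(φ)` is zero.
[cite: SilvermanAEC2009, Thm. X.4.2(a)] -/
theorem eq_zero_of_shaMap_fiveIsogeny_eq_zero (h5 : ¬ (5 : ℤ) ∣ (kubertTateFive m n).Δ)
    (h1 : ∀ p : ℕ, p.Prime → (p : ℤ) ∣ (kubertTateFive m n).Δ → p % 5 ≠ 1)
    {c : (kubertTateFive (m : ℚ) (n : ℚ)).sha}
    (hc : shaMap (fiveIsogeny (m : ℚ) (n : ℚ)).toAddMonoidHom (fiveIsogeny (m : ℚ) (n : ℚ)).equivariant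
      (fiveIsogeny (m : ℚ) (n : ℚ)).hasLocalPointsMaps_toAddMonoidHom c = 0) : c = 0 := by
  have hmem := (AddMonoidHom.mem_ker).mpr hc
  rw [ker_shaMap_fiveIsogeny_eq_bot m n h5 h1] at hmem
  exact (AddSubgroup.mem_bot).mp hmem

end Rat

/-! ### The instance `(m, n) = (13, 14)` -/

section Instance1314

/-- `E_{13/14} = [1, -182, -2548, 0, 0]` is elliptic: `Δ = -405171591170528 ≠ 0`.
[cite: Kubert1976, Table 3 (N = 5)] -/
theorem isElliptic_13_14 : (kubertTateFive ((13 : ℤ) : ℚ) ((14 : ℤ) : ℚ)).IsElliptic := by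
  refine ⟨isUnit_iff_ne_zero.mpr ?_⟩
  rw [eq_map_int 13 14, map_Δ, kubertTateFive_Δ]
  norm_num

/-- **The instance `(m, n) = (13, 14)`** (`E_{13/14} = [1, -182, -2548, 0, 0]`,
`Δ = -2⁵·7⁵·13⁵·2029`, rank `2` numerically): the hypotheses of the class-wide theorem hold
(`5 ∤ Δ`; the bad primes `2, 7, 13, 2029` are `≢ 1 (mod 5)`), so `Sel^φ(E_{13/14}/ℚ) = 0` — the
theorem `KubertTate1314.selmerGroup_fiveIsogeny_eq_bot`, now as a specialisation of the family.
[cite: Fisher2001FiveSevenDescent, §§1–2] -/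
theorem selmerGroup_fiveIsogeny_eq_bot_13_14 :
    haveI := isElliptic_13_14
    (fiveIsogeny ((13 : ℤ) : ℚ) ((14 : ℤ) : ℚ)).selmerGroup = ⊥ := by
  haveI := isElliptic_13_14
  refine selmerGroup_fiveIsogeny_eq_bot 13 14 (by rw [kubertTateFive_Δ]; norm_num) ?_
  intro p hp hdvd
  rw [kubertTateFive_Δ] at hdvd
  norm_num at hdvd
  -- `Δ = -405171591170528 = -(2⁵·7⁵·13⁵·2029)`
  have h2029 : Nat.Prime 2029 := by norm_num
  have hdvdN : p ∣ 2 ^ 5 * 7 ^ 5 * 13 ^ 5 * 2029 := by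
    have h' : (p : ℤ) ∣ ((2 ^ 5 * 7 ^ 5 * 13 ^ 5 * 2029 : ℕ) : ℤ) := by
      have e : ((2 ^ 5 * 7 ^ 5 * 13 ^ 5 * 2029 : ℕ) : ℤ) = 405171591170528 := by norm_num
      rw [e]; exact hdvd
    exact Int.natCast_dvd_natCast.mp h'
  have hpi := Nat.Prime.prime hp
  rcases hpi.dvd_or_dvd hdvdN with h | h
  · rcases hpi.dvd_or_dvd h with h | h
    · rcases hpi.dvd_or_dvd h with h | h
      · have := (Nat.prime_dvd_prime_iff_eq hp Nat.prime_two).mp (hpi.dvd_of_dvd_pow h); omega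
      · have := (Nat.prime_dvd_prime_iff_eq hp (by norm_num)).mp (hpi.dvd_of_dvd_pow h); omega
    · have := (Nat.prime_dvd_prime_iff_eq hp (by norm_num)).mp (hpi.dvd_of_dvd_pow h); omega
  · have := (Nat.prime_dvd_prime_iff_eq hp h2029).mp h; omega

end Instance1314


end KubertTateVelu

end Literature.NumberTheory.EllipticCurves

end
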